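import Literature.MathematicalPhysics.QuantumFieldTheory.Balaban1983to89.B9Eq387CubeLocalisedProjectionBumpSection
import Literature.MathematicalPhysics.QuantumFieldTheory.Balaban1983to89.B9Eq388KhLettersUnitWindow
import Literature.MathematicalPhysics.QuantumFieldTheory.Balaban1983to89.B9Eq387CubeCutoffProfile

/-!
# `Balaban1983to89.B9Eq389CubeLocalisedProjectionProfile` — T. Bałaban, *Propagators for lattice gauge theories in a background field*, Commun. Math. Phys.
# **99** (1985) 389–434 [Balaban1985BackgroundPropagators] Cor 3.6 p. 408 with (3.87)–(3.89) p. 409, Thm 3.11 p. 416, (3.19) p. 393, (3.23) p. 394, (3.49) p. 399: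
# **S-P6′(β) AT THE LATTICE WITH NO OPERATOR SLOT LEFT.  ne9-leaf-06 g69's junction `B9Eq387CubeLocalisedProjectionBumpSection.norm_sub_projR_blockHull_le_of_unitWindow_coercive`
# ((β) in the unit window with the bump section `Ψ`, `C_Ψ`, the block-Poincaré `c_P` and the positivity of `Δ′_{a′}(U)` supplied) still displays the two
# COMMUTATOR slots `ha` (`a₁, a₀`) and `hb` (`b₀`) and the cut-off DEVICES `θ` (fine sites) and `θ_F` (coarse sites).  Here `ha`, `hb` are DISCHARGED by
# ne9-leaf-05 g77's `B9Eq388KhLettersUnitWindow` and `θ, θ_F` are ELIMINATED from the statement (built inside the proof from ONE REAL PROFILE `σ` by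
# `B9Eq387IMSLocalLettersLattice.exists_pointwise_clm`): for `w` supported over `Y₀`,
# `‖w − projR Δ^η_U (Q′ × N.mkQ) w‖ ≤ ‖w − R(U)w‖ + (C·K_d(κ∕2)·e^{−(κ∕2)r₀} + a₁c_P + (a₀ + C_Ψb₀)c_P²)·‖w‖` with `c_P = (√γ)⁻¹`, `a₁ = √dℓ₁(M_φM_φ′ + 1)`,
# `a₀ = dℓ₂`, `b₀ = (1 + 2M_φM_φ′ε)^{d(L−1)}dℓ₁` and `C_Ψ` (K6E)'s constant — ALL letters by defining equations; the ONLY displayed SIZE letter is the block decay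
# `(C, κ)` of `1 − R(U)` on a (K1) block family** — route R2′ STEP B7′∕B8′, S-P6′(β), instance-ledger row L10 (loc) of the pub-balaban NE9 chain

statement-level skeleton of published theorems with citation tags; proofs where landed; nothing here is a claim about the Yang–Mills mass gap

CITATION HEADER (lean-in-tree rule).  Audit cell `pub-balaban`, sub-cell `t4`, BINDER row NE9; filed by NE9 formalisation-swarm LEAF PROVER 05
(`b2b-balaban-t4-ne9-formalise-leaf-05`, gen 77) as the COMPOSITION BY NAME of ne9-leaf-06 g69's `B9Eq387CubeLocalisedProjectionBumpSection.norm_sub_projR_blockHull_le_of_unitWindow_coercive`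
(§3 of their INTENT-3, journal 2026-08-23 l.54426 ∕ l.54483 — itself the junction of ne9-leaf-06's abstract (β) `B9Eq387CubeLocalisedProjection`, the lattice junction
`B9Eq387CubeLocalisedProjectionLattice`, this lineage's (K6S)∕(K6T)∕(K6E) and `B9Eq349ConjugatedDPCircleClosed.coercive_of_canonical_diagonal`) with this lineage's
`B9Eq388KhLettersUnitWindow.norm_covLaplace_comm_le_unitWindow` (`ha`) ∕ `norm_Qprime_comm_le_unitWindow_diagonal` (`hb`), this lineage's
`B9Eq387CubeCutoffProfile.exists_cube_cutoff_profile_letters` (the profile, §2) and ne9-leaf-01's `B9Eq387IMSLocalLettersLattice.exists_pointwise_clm` (the multipliers).  Source READ in the held text [Balaban1985BackgroundPropagators]: p. 408 Cor 3.6 and «h_□»,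
p. 409 (3.87)–(3.89) *«… can be bounded by a small factor O(M⁻¹) … together with the exponential decay»*, p. 416 Thm 3.11, p. 393 (3.19), p. 394 (3.23), p. 399
(3.49).  NOTHING of print's estimates is asserted; every number of print stays a LETTER — the constants below are the cell's [folklore] bookkeeping of its own objects.

WHAT IS PROVED (sorry-free; proof lane — no `def`; [folklore] composition BY NAME).
* **`norm_sub_projR_blockHull_le_of_profile`** — S-P6′(β) at the lattice in the unit window for ONE REAL PROFILE `σ` on the fine torus (`|σ − 1| ≤ 1`; `σ = 1` on
  the blocks within `r₀ > 0` of `Y₀ ⊇ supp w`; `σ = 0` off the blocks over the cube `Y`; slope letters `|σ(b₋) − σ(b₊)| ≤ ℓ₁η`, `|second differences| ≤ ℓ₂η²`),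
  the structure (`3 ≤ L`, `Lη = 1`, `c₀L^d = c₁`, `φ` with `M_φ, M_φ′`, `U(b) ∈ U₁`, `‖U(b) − 1‖ ≤ ε`, the collinear-bond letter `β₂`, `hRS`, `0 < a′`, `1 ≤ m_i`),
  the cube submodule `N` (membership letter `hN`), the block decay `(C, κ)` of `1 − R(U)` on a (K1) block family, and the scalar windows `3^dρ′ < 1`, `0 < γ ≤ c_Δ`:
  the displayed conclusion above, `c_P, a₁, a₀, b₀, C_Ψ` LETTERS WITH DEFINING EQUATIONS (consumers pass `rfl`).
* §2 **`norm_sub_projR_collar_le`** — the same for the COLLAR CUBE `Y = (r₀ + R)`-neighbourhood of `Y₀` with the profile OBTAINED from this lineage's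
  `B9Eq387CubeCutoffProfile.exists_cube_cutoff_profile_letters`: NO profile letter in the statement; `a₁ = √d(L∕R)(M_φM_φ′ + 1)`, `a₀ = 2dL²∕R`,
  `b₀ = (1 + 2M_φM_φ′ε)^{d(L−1)}dL∕R` — the near field is `O(1∕R)`.
HONEST SCOPE.  A junction: two commutator slots discharged, two devices eliminated; the block decay `(C, κ)` (ne9-leaf-01 g85's `B9Eq349PBlockDecayWindow` `∃`-package in
the `ε₀`-window ∕ this lineage's (K6P) at `U ≡ 1`) and the scalar windows are NOT addressed (§1 displays the profile; §2 obtains it for the collar cube); the cube MODEL is the block hull; ONE averaging step; diagonal `Lη = 1`.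
NOT NE9 (cell pub-balaban: NE9 NOT PRINTED ∕ NOT PROVED; «NE9 ⇐ the named binders»; row WALLED ON A MODEL (O-NE9-1; #5 UNRULED); spine PROVED 0∕9; rung (B)+1 on a
finite T⁴ — NOT infinite volume, NOT mass gap, NOT Clay; HONEST DEPENDENCY: continuum YM on T⁴ ⇐ BetaPertH ∧ nine spine estimates (0/9 proved); BetaPertH ⇐ (D1) ∧
(D4) ∧ CAP+tail; G-an2-4 gates asym, D1 and NE2/3/4).  NEW file; nothing modified.  Net new unproved facts: 0.
v1.2 (gen 85): v1.1 (p373832, 2026-08-23) elaborated on the farm once its parents built and was bounced `dedup.landed` because §1's SOURCE-LEVEL signature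
(`(hm) (w) (hw) : ‖w − projR Δs (Q′ × N.mkQ) w‖ ≤ …`, every other hypothesis in `variable … include`) reads token for token like the lattice junction
`B9Eq387CubeLocalisedProjectionLattice.norm_sub_projR_blockHull_le` — whose HYPOTHESES differ (it displays `θ`, `θ_F`, `Ψ`, `c_P`, `ha`, `hb`; §1 here
discharges ∕ eliminates them).  v1.2 moves the profile `σ` and its letters from `variable` into §1's binders so the displayed statement shows what §1 is about;
MATHEMATICAL CONTENT, PROOFS AND §2's SIGNATURE BYTE-IDENTICAL to v1.1 (only §2's internal call re-ordered).
-/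

noncomputable section

set_option autoImplicit false

open scoped InnerProductSpace BigOperators

namespace Literature.MathematicalPhysics.QuantumFieldTheory.Balaban1983to89.B9Eq389CubeLocalisedProjectionProfile

open B4Sect5Torus (TSite tdist)
open B4Sect5Proof (latticeConst)
open B9SectCLatticeCarrier (Bond bpos btgt shift unshift)
open B9Eq311L2Pairing (WL2)
open B9Eq319QprimeTorus (fineP blockCoord centre)
open B11Eq103H1Complex (SiteL2K BondL2K covDerivL2K covLaplaceSiteK projR)
open B7Prop1Explicit (U1)
open B9Eq310HessianOperator (adTransportW)
open B9Eq326OperatorAssembly (QprimeW RofU)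
open B9Eq387IMSLocalLettersLattice (exists_pointwise_clm)
open B9Eq387CubeLocalisedProjectionBumpSection (norm_sub_projR_blockHull_le_of_unitWindow_coercive)
open B9Eq388KhLettersUnitWindow (norm_covLaplace_comm_le_unitWindow norm_Qprime_comm_le_unitWindow_diagonal)
open B9Eq387CubeCutoffProfile (exists_cube_cutoff_profile_letters)

variable {d : ℕ} (L : ℕ) [NeZero L] (m : Fin d → ℕ) [∀ i, NeZero (fineP L m i)] {𝔸 : Type*} [NormedRing 𝔸] [NormedAlgebra ℂ 𝔸] [NormOneClass 𝔸]
  {W : Type*} [NormedAddCommGroup W] [InnerProductSpace ℂ W] [FiniteDimensional ℂ W] (φ : W ≃ₗ[ℂ] 𝔸)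
  {c₀ : ℝ} [Fact (0 < c₀)] {c₁ : ℝ} [Fact (0 < c₁)] (η : ℝ) (U : Bond d (fineP L m) → 𝔸ˣ)
  -- the scale letters
  (hL : 3 ≤ L) (hLη : (L : ℝ) * η = 1) (hc : c₀ * (L : ℝ) ^ d = c₁)
  -- the (K1) block family and the block-decay letter of `1 − R(U)` (as in the junction files)
  {PS : TSite d m → SiteL2K ℂ d (fineP L m) c₀ W →L[ℂ] SiteL2K ℂ d (fineP L m) c₀ W}
  (hPS : ∀ (y : TSite d m) (f : SiteL2K ℂ d (fineP L m) c₀ W) (x : TSite d (fineP L m)),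
    WL2.equiv ℂ (fun _ : TSite d (fineP L m) => c₀) W (PS y f) x =
      if blockCoord L m x = y then WL2.equiv ℂ (fun _ : TSite d (fineP L m) => c₀) W f x else 0)
  {C κ : ℝ} (hC : 0 ≤ C) (hκ : 0 < κ)
  (hdec : ∀ y₀ y₁ : TSite d m, ‖PS y₁ ∘L LinearMap.toContinuousLinearMap (LinearMap.id - RofU L m φ η U (c₀ := c₀)) ∘L PS y₀‖ ≤
    C * Real.exp (-(κ * tdist m y₀ y₁)))
  -- the coarse cube set `Y` and the profile's slope letters `ℓ₁, ℓ₂` (the profile `σ` itself and its letters are binders of §1's theorem, v1.2)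
  {Y : Set (TSite d m)} {ℓ₁ ℓ₂ : ℝ}
  -- the cube submodule
  {N : Submodule ℂ (SiteL2K ℂ d (fineP L m) c₀ W)}
  (hN : ∀ f : SiteL2K ℂ d (fineP L m) c₀ W, f ∈ N ↔ ∀ x : TSite d (fineP L m), blockCoord L m x ∉ Y → WL2.equiv ℂ _ W f x = 0)
  -- the unit window
  (hRS : ∀ (b : Bond d (fineP L m)) (v u : W), ⟪adTransportW φ U b v, u⟫_ℂ = ⟪v, adTransportW φ (fun b => (U b)⁻¹) b u⟫_ℂ)
  {Mφ Mφ' : ℝ} (hMφ : 0 ≤ Mφ) (hφ : ∀ w, ‖φ w‖ ≤ Mφ * ‖w‖) (hMφ' : 0 ≤ Mφ') (hφ' : ∀ X, ‖φ.symm X‖ ≤ Mφ' * ‖X‖)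
  (hU1 : ∀ b, U b ∈ U1 𝔸) {ε β₂ : ℝ} (hε : 0 ≤ ε) (hUε : ∀ b, ‖(U b : 𝔸) - 1‖ ≤ ε) (hβ : 0 ≤ β₂)
  (hcol : ∀ (y : TSite d (fineP L m)) (μ : Fin d), ‖(U (y, μ) : 𝔸) - U (unshift μ y, μ)‖ ≤ β₂)
  (hq : 3 ^ d * ((1 + 2 * Mφ * Mφ' * ε) ^ (d * (L - 1)) - 1) < 1)
  {a' : ℝ} (ha' : 0 < a') {γ : ℝ} (hγ : 0 < γ)
  (hγc : γ ≤ 1 / (2 + 2 / a') -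
      (Real.sqrt d * (‖((η : ℂ))⁻¹‖ * (2 * Mφ * Mφ' * ε)) + (Real.sqrt d * (‖((η : ℂ))⁻¹‖ * (2 * Mφ * Mφ' * ε))) ^ 2 +
        a' * (((1 + 2 * Mφ * Mφ' * ε) ^ (d * (L - 1)) - 1)) * (2 + ((1 + 2 * Mφ * Mφ' * ε) ^ (d * (L - 1)) - 1))))
  -- the two operators of the conclusion as LETTERS with defining equations (consumers pass `rfl`)
  (Δs : SiteL2K ℂ d (fineP L m) c₀ W →ₗ[ℂ] SiteL2K ℂ d (fineP L m) c₀ W)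
  (hΔs : Δs = covLaplaceSiteK ((η : ℂ))⁻¹ (adTransportW φ U) (adTransportW φ fun b => (U b)⁻¹))
  (Q' : SiteL2K ℂ d (fineP L m) c₀ W →ₗ[ℂ] SiteL2K ℂ d m c₁ W)
  (hQ' : Q' = (WL2.linearEquiv ℂ ℂ (fun _ : TSite d m => c₁)).symm.toLinearMap ∘ₗ QprimeW L m φ U (c₀ := c₀))
  -- the five constants as LETTERS with defining equations
  {cP a₁ a₀ b₀ CΨ : ℝ} (hcP : cP = (Real.sqrt γ)⁻¹) (ha₁ : a₁ = Real.sqrt d * (ℓ₁ * (Mφ * Mφ' + 1))) (ha₀ : a₀ = d * ℓ₂)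
  (hb₀ : b₀ = (1 + 2 * Mφ * Mφ' * ε) ^ (d * (L - 1)) * (d * ℓ₁))
  (hCΨ : CΨ = (1 - 3 ^ d * ((1 + 2 * Mφ * Mφ' * ε) ^ (d * (L - 1)) - 1))⁻¹ *
    (d * (3 / 2 : ℝ) ^ d * (9 * Real.pi ^ 2) * 2 ^ (d - 1) + d * 3 ^ d * ((L : ℝ) ^ 2 * (Mφ' * Mφ * (2 * β₂ + 4 * ε ^ 2))) +
      d * (3 / 2 : ℝ) ^ d * (6 * Real.pi) * 2 ^ (d - 1) * ((L : ℝ) * (2 * Mφ * Mφ' * ε))))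

include hL hLη hc hPS hC hκ hdec hN hRS hMφ hφ hMφ' hφ' hU1 hε hUε hβ hcol hq ha' hγ hγc hΔs hQ' hcP ha₁ ha₀ hb₀ hCΨ in
/-- **S-P6′(β) AT THE LATTICE FOR ONE REAL PROFILE — NO OPERATOR SLOT LEFT** (Cor 3.6 with (3.87)–(3.89); Thm 3.11; (3.19), (3.23), (3.49)): under the structure
letters of the unit window (`3 ≤ L`, `Lη = 1`, `c₀L^d = c₁`, `φ` with `M_φ, M_φ′`, `U(b) ∈ U₁`, `‖U(b) − 1‖ ≤ ε`, the collinear-bond letter `β₂`, `hRS`, `0 < a′`),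
the cube submodule `N` over `Y` (letter `hN`), a (K1) block family carrying the block-decay letter `(C, κ)` of `1 − R(U)`, ONE REAL PROFILE `σ` (`|σ − 1| ≤ 1`,
`= 1` on the blocks within `r₀ > 0` of `Y₀`, `= 0` off the blocks over `Y`, slopes `ℓ₁η`, `ℓ₂η²`) and the scalar windows `3^dρ′ < 1`, `0 < γ ≤ c_Δ`:  for every `w`
supported over `Y₀`, `‖w − projR Δ^η_U (Q′ × N.mkQ) w‖ ≤ ‖w − R(U)w‖ + (C·K_d(κ∕2)·e^{−(κ∕2)r₀} + a₁c_P + (a₀ + C_Ψb₀)c_P²)·‖w‖` with the LETTERS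
`c_P = (√γ)⁻¹`, `a₁ = √dℓ₁(M_φM_φ′ + 1)`, `a₀ = dℓ₂`, `b₀ = (1 + 2M_φM_φ′ε)^{d(L−1)}dℓ₁`, `C_Ψ` = (K6E)'s constant.  [folklore] composition BY NAME: the devices
`θ = σ·` (fine) and `θ_F = σ(L·)·` (coarse) are built by `exists_pointwise_clm`; `ha` ∕ `hb` are `norm_covLaplace_comm_le_unitWindow` ∕ `norm_Qprime_comm_le_unitWindow_diagonal`.
[cite: Balaban1985BackgroundPropagators, Cor 3.6 p.408, (3.87)–(3.89) p.409, Thm 3.11 p.416, (3.19) p.393, (3.23) p.394, (3.49) p.399] -/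
theorem norm_sub_projR_blockHull_le_of_profile
    -- ONE real profile: flat top near the support, zero off the cube, slope letters
    {σ : TSite d (fineP L m) → ℝ} (hσ1 : ∀ x : TSite d (fineP L m), |σ x - 1| ≤ 1) (Y₀ : Finset (TSite d m)) {r₀ : ℝ} (hr₀ : 0 < r₀)
    (hnear : ∀ x : TSite d (fineP L m), (∃ y₀ ∈ Y₀, tdist m y₀ (blockCoord L m x) < r₀) → σ x = 1)
    (hσY : ∀ x : TSite d (fineP L m), blockCoord L m x ∉ Y → σ x = 0)
    (hℓ₁ : 0 ≤ ℓ₁) (hℓ₂ : 0 ≤ ℓ₂) (h1 : ∀ b : Bond d (fineP L m), |σ (bpos b) - σ (btgt b)| ≤ ℓ₁ * η)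
    (h2 : ∀ (y : TSite d (fineP L m)) (μ : Fin d), |(σ y - σ (unshift μ y)) - (σ (shift μ y) - σ y)| ≤ ℓ₂ * η ^ 2)
    (hm : ∀ i, 1 ≤ m i) (w : SiteL2K ℂ d (fineP L m) c₀ W)
    (hw : ∀ x : TSite d (fineP L m), blockCoord L m x ∉ Y₀ → WL2.equiv ℂ (fun _ : TSite d (fineP L m) => c₀) W w x = 0) :
    ‖w - projR Δs (Q'.prod N.mkQ) w‖ ≤
      ‖w - RofU L m φ η U (c₀ := c₀) w‖ + (C * latticeConst d (κ / 2) * Real.exp (-(κ / 2 * r₀)) + a₁ * cP + (a₀ + CΨ * b₀) * cP ^ 2) * ‖w‖ := by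
  -- the two devices, built from the profile (pointwise multipliers on the fine and on the coarse carrier)
  obtain ⟨θc, hθc⟩ := exists_pointwise_clm (𝕜 := ℂ) (w := fun _ : TSite d (fineP L m) => c₀) (V := W) (fun x : TSite d (fineP L m) => x) σ
  obtain ⟨θFc, hθFc⟩ := exists_pointwise_clm (𝕜 := ℂ) (w := fun _ : TSite d m => c₁) (V := W) (centre L m) σ
  have hθ : ∀ (f : SiteL2K ℂ d (fineP L m) c₀ W) (x : TSite d (fineP L m)),
      WL2.equiv ℂ (fun _ : TSite d (fineP L m) => c₀) W ((θc : SiteL2K ℂ d (fineP L m) c₀ W →ₗ[ℂ] SiteL2K ℂ d (fineP L m) c₀ W) f) x =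
        (σ x : ℂ) • WL2.equiv ℂ (fun _ : TSite d (fineP L m) => c₀) W f x := fun f x => hθc f x
  have hθF : ∀ (g : SiteL2K ℂ d m c₁ W) (y : TSite d m),
      WL2.equiv ℂ (fun _ : TSite d m => c₁) W ((θFc : SiteL2K ℂ d m c₁ W →ₗ[ℂ] SiteL2K ℂ d m c₁ W) g) y =
        (σ (centre L m y) : ℂ) • WL2.equiv ℂ (fun _ : TSite d m => c₁) W g y := fun g y => hθFc g y
  -- the profile letters in the junction's (complex) spelling
  have hσ1' : ∀ x : TSite d (fineP L m), ‖(σ x : ℂ) - 1‖ ≤ 1 := fun x => by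
    rw [← Complex.ofReal_one, ← Complex.ofReal_sub, Complex.norm_real, Real.norm_eq_abs]; exact hσ1 x
  have hnear' : ∀ x : TSite d (fineP L m), (∃ y₀ ∈ Y₀, tdist m y₀ (blockCoord L m x) < r₀) → (σ x : ℂ) = 1 := fun x hx => by
    rw [hnear x hx, Complex.ofReal_one]
  have hσ' : ∀ x : TSite d (fineP L m), blockCoord L m x ∉ Y → (σ x : ℂ) = 0 := fun x hx => by
    rw [hσY x hx, Complex.ofReal_zero]
  -- the two commutator slots
  have hL0 : (0 : ℝ) < (L : ℝ) := by exact_mod_cast NeZero.pos L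
  have hη : 0 < η := by
    have : η = 1 / (L : ℝ) := by rw [eq_div_iff hL0.ne', mul_comm]; exact hLη
    rw [this]; positivity
  have ha : ∀ u, ‖Δs ((θc : SiteL2K ℂ d (fineP L m) c₀ W →ₗ[ℂ] SiteL2K ℂ d (fineP L m) c₀ W) u) -
      (θc : SiteL2K ℂ d (fineP L m) c₀ W →ₗ[ℂ] SiteL2K ℂ d (fineP L m) c₀ W) (Δs u)‖ ≤
        a₁ * ‖covDerivL2K ℂ c₀ ((η : ℂ))⁻¹ (adTransportW φ U) u‖ + a₀ * ‖u‖ := fun u => by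
    rw [ha₁, ha₀]
    exact norm_covLaplace_comm_le_unitWindow φ hMφ hφ hMφ' hφ' U hU1 hη hℓ₁ hℓ₂ h1 h2 _ hθ _ rfl Δs hΔs u
  have hb : ∀ u, ‖Q' ((θc : SiteL2K ℂ d (fineP L m) c₀ W →ₗ[ℂ] SiteL2K ℂ d (fineP L m) c₀ W) u) -
      (θFc : SiteL2K ℂ d m c₁ W →ₗ[ℂ] SiteL2K ℂ d m c₁ W) (Q' u)‖ ≤ b₀ * ‖u‖ := fun u => by
    rw [hb₀]
    exact norm_Qprime_comm_le_unitWindow_diagonal φ hMφ hφ hMφ' hφ' L m U hU1 hε hUε hLη hℓ₁ hc h1 _ hθ _ hθF Q' hQ' u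
  have ha₁0 : 0 ≤ a₁ := by rw [ha₁]; positivity
  have ha₀0 : 0 ≤ a₀ := by rw [ha₀]; positivity
  have hb₀0 : 0 ≤ b₀ := by rw [hb₀]; positivity
  exact norm_sub_projR_blockHull_le_of_unitWindow_coercive L m φ η U hL hLη hc hPS hθ hσ1' Y₀ hr₀ hnear' hC hκ hdec hRS a'
    (covDerivL2K ℂ c₀ ((η : ℂ))⁻¹ (adTransportW φ U)) rfl Δs hΔs Q' hQ' hN hσ'
    (θFc : SiteL2K ℂ d m c₁ W →ₗ[ℂ] SiteL2K ℂ d m c₁ W) ha₁0 ha₀0 hb₀0 ha hb hMφ hφ hMφ' hφ' hU1 hε hUε hβ hcol hq hCΨ ha' hγ hγc hcP hm w hw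

/-! ## §2 The collar cube: the profile obtained from `B9Eq387CubeCutoffProfile`, no profile letter left -/

include hL hLη hc hPS hC hκ hdec hRS hMφ hφ hMφ' hφ' hU1 hε hUε hβ hcol hq ha' hγ hγc hΔs hQ' hcP hCΨ in
/-- **S-P6′(β) AT THE LATTICE FOR THE COLLAR CUBE — NO PROFILE, NO DEVICE, NO SLOT** (Cor 3.6 with (3.87)–(3.89); p. 408 «h_□ = 1 on □, supported in □̃»):
the cube is the `(r₀ + R)`-neighbourhood `Y = {y : ∃ y₀ ∈ Y₀, d_m(y₀, y) < r₀ + R}` of the support set `Y₀` (`0 < r₀`, collar width `0 < R`), `N` its submodule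
(letter `hN`); the cut-off profile is OBTAINED from `B9Eq387CubeCutoffProfile.exists_cube_cutoff_profile_letters` (`ℓ₁ = L∕R`, `ℓ₂ = 2L²∕R`).  THEN for every
`w` supported over `Y₀`: `‖w − projR Δ^η_U (Q′ × N.mkQ) w‖ ≤ ‖w − R(U)w‖ + (C·K_d(κ∕2)·e^{−(κ∕2)r₀} + a₁c_P + (a₀ + C_Ψb₀)c_P²)·‖w‖` with the LETTERS
`c_P = (√γ)⁻¹`, `a₁ = √d·(L∕R)·(M_φM_φ′ + 1)`, `a₀ = d·(2L²∕R)`, `b₀ = (1 + 2M_φM_φ′ε)^{d(L−1)}·d·(L∕R)`, `C_Ψ` = (K6E)'s constant — the near field is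
`O(1∕R)` («O(M⁻¹)»), the tail `e^{−(κ∕2)r₀}`; the ONLY displayed SIZE letter is the block decay `(C, κ)` of `1 − R(U)`. [folklore] composition BY NAME.
[cite: Balaban1985BackgroundPropagators, Cor 3.6 p.408, (3.87)–(3.89) p.409, Thm 3.11 p.416, (3.19) p.393, (3.23) p.394, (3.49) p.399] -/
theorem norm_sub_projR_collar_le (Y₀ : Finset (TSite d m)) {r₀ R : ℝ} (hr₀ : 0 < r₀) (hR : 0 < R)
    {N : Submodule ℂ (SiteL2K ℂ d (fineP L m) c₀ W)}
    (hN : ∀ f : SiteL2K ℂ d (fineP L m) c₀ W, f ∈ N ↔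
      ∀ x : TSite d (fineP L m), blockCoord L m x ∉ {y : TSite d m | ∃ y₀ ∈ Y₀, tdist m y₀ y < r₀ + R} → WL2.equiv ℂ _ W f x = 0)
    {a₁ a₀ b₀ : ℝ} (ha₁ : a₁ = Real.sqrt d * ((L : ℝ) / R * (Mφ * Mφ' + 1))) (ha₀ : a₀ = d * (2 * (L : ℝ) ^ 2 / R))
    (hb₀ : b₀ = (1 + 2 * Mφ * Mφ' * ε) ^ (d * (L - 1)) * (d * ((L : ℝ) / R)))
    (hm : ∀ i, 1 ≤ m i) (w : SiteL2K ℂ d (fineP L m) c₀ W)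
    (hw : ∀ x : TSite d (fineP L m), blockCoord L m x ∉ Y₀ → WL2.equiv ℂ (fun _ : TSite d (fineP L m) => c₀) W w x = 0) :
    ‖w - projR Δs (Q'.prod N.mkQ) w‖ ≤
      ‖w - RofU L m φ η U (c₀ := c₀) w‖ + (C * latticeConst d (κ / 2) * Real.exp (-(κ / 2 * r₀)) + a₁ * cP + (a₀ + CΨ * b₀) * cP ^ 2) * ‖w‖ := by
  obtain ⟨σ, hσ1, hnear, hσY, h1, h2⟩ := exists_cube_cutoff_profile_letters L m hm hLη Y₀ (r₀ := r₀) hR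
  have hL0 : (0 : ℝ) ≤ (L : ℝ) := Nat.cast_nonneg L
  have hℓ₁ : (0 : ℝ) ≤ (L : ℝ) / R := div_nonneg hL0 hR.le
  have hℓ₂ : (0 : ℝ) ≤ 2 * (L : ℝ) ^ 2 / R := by positivity
  exact norm_sub_projR_blockHull_le_of_profile L m φ η U hL hLη hc hPS hC hκ hdec hN hRS hMφ hφ hMφ' hφ' hU1 hε hUε hβ hcol hq ha' hγ hγc
    Δs hΔs Q' hQ' hcP ha₁ ha₀ hb₀ hCΨ hσ1 Y₀ hr₀ hnear hσY hℓ₁ hℓ₂ h1 h2 hm w hw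

end Literature.MathematicalPhysics.QuantumFieldTheory.Balaban1983to89.B9Eq389CubeLocalisedProjectionProfile

end
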